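import Summits.QuantumFields.BalabanUV.Beta.SpineRecursive
import Summits.QuantumFields.BalabanUV.Beta.StepReflectionRec
import Summits.QuantumFields.BalabanUV.Beta.S0NAtReflection
import Summits.QuantumFields.BalabanUV.Beta.RelInvBorderedHessianStep
import Summits.QuantumFields.BalabanUV.Beta.DiagonalContactLoc
import Summits.QuantumFields.BalabanUV.Beta.KernelWardLevels

/-!
# `hR` FOR THE RECURSIVELY TYPED WALL FAMILY `JsRecBmAtOf` BY INDUCTION ON THE LEVEL: the (Sr-conj) socket at EVERY level from the level-`0`
# law (an3's `S0NAt_bref`), the LEVEL-GENERIC CONTACT LAW of the cubic sector (hypothesis `hCT`, one implication per level) and the UNITS LOCKS;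
# hence `hR ⟸ EXACTLY {hCT, locks, (L4)}` (β sub-cell, row BETA-an2 = BINDER-OWNERS row D1, gen 16; decision (L3-D′))

HONEST FRAMING (cell charter, verbatim): «discharging BetaPertH makes Balaban's UV stability UNCONDITIONAL — a real
constructive-QFT result; it is NOT the continuum limit and NOT the Clay problem.»  DERIVED cell leaf (pub-balaban β sub-cell, lane
an2 gen 16); no statement of Bałaban's papers is typed here, no `[cite:]` tag, no `Prop` fact; it instantiates no binder of the
β-function wall by itself.  NOT `BetaPertH`; NOT continuum; NOT Clay.

## What is here ([folklore] wiring + one induction; `d + 1 = 4`, odd `Lc`, centred root `ρ_c = toSite (ctrOff 4 Lc)`)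

Write `G_j := coDressKBmAt ρ_c Lc (KInvStep Lc j)`, `𝕄_j := bhKStepAt 3 ρ_c Lc j`, `S_j := WardLocusRecursive.SrecAt 3 Lc ρ_c cE cVH cΛ j`,
`γ_j := cVH·wVH j / (stepScale j·Lc⁴)` (so `γ_0 = cVH / Lc⁴`), and the two level-indexed statements
* (P j) THE (Sr-conj) LAW OF `S_j`: `∀ α κ u, S_j κ (bref α κ u) = reflSign α κ • refK (Φ Lc α) (S_j κ u + conjV 𝕄_j (γ_j • diagK (ctGen 3 α Lc κ u)))`;
* (Q j) THE ff-LAW OF THE CUBIC SECTOR OF `S_{j+1}`: `e3OfK Lc G_j S_j κ′ (bref α κ′ u′) =ff= reflSign α κ′·s_a·s_b·(e3OfK Lc G_j S_j κ′ u′ (r x) (r z) +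
  (γ_j / (stepScale j·Lc⁴·wVH (j+1))) · conjV 𝕄_{j+1} (diagK (ctGen 3 α Lc κ′ u′)) (r x) (r z))` (`𝕄_{j+1}`'s field block is `wVH (j+1) • mmRead Lc G_j`,
  `WardLocusInduction.mmRead_coDressKBmAt_KInvStep`; the coefficient is the multiplier leg `(stepScale j·Lc⁴)⁻¹` of rule `.EMA` of `RelInv G_j 𝕄_j axEc`).
* **`hSrC_SrecAt_all_of_contactLaw`**: under `2·cVH = −cE·Lc⁴` (level `0`: an3's `S0NAtReflection.S0NAt_bref`), the LEVEL-GENERIC CONTACT LAW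
  `hCT : ∀ j, P j → Q j` and the UNITS LOCKS `hlock : ∀ j, cE·wE (j+1)·(γ_j / (stepScale j·Lc⁴·wVH (j+1))) = γ_{j+1}`: `∀ j, P j` (induction; the step
  is `StepReflectionRec.SrecAt_succ_bref_of_e3Law` with `𝕄 := 𝕄_{j+1}`, `s := stepScale (j+1)`).
* `locks_of_pin`: the locks hold at EVERY level as soon as `∀ j, cE·wE (j+1) = stepScale (j+1)³·Lc⁴` (leaf-10's `WardLocusInduction.stepLocks_iff`
  form; at the tree's numerals `wE = stepScale³` this is `cE = Lc⁴`, `locks_of_bcj_pin`) — THE SAME PIN AS THE WARD BINDER.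
* **`axisReflectionCovariant_flipK_TbalOf_JsRecBmAtOf_ctrC_inductive`**: `∀ j, AxisReflectionCovariant (flipK (TbalOf Lc (JsRecBmAtOf …) j))` from EXACTLY:
  the W-data (`VertexFamily₂`, (Wt)), `hn`, `hCT`, `hlock`, and the W-supplier's sockets `X₂`/`hX₂`/`hEX₂`/`hWrC` (against `𝕄_j`, contact symbol
  `γ_j • diagK ctGen`) — rules 1–4 (`relInv_coDressKBmAt_KInvStep_bhKStepAt`, every `j`), the contact family's localisation and commutation with `axEc`,
  and hSrC (the induction) are DISCHARGED inside.  `…_inductive_bcj`: the same at the pin `cE = Lc⁴`, `cVH = −Lc⁸/2` with `hlock` discharged.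

WHAT `hCT` IS (honest): the resolvent-generic contact evaluation of lineage an3 (`E3GenericReflection`/`VertexSandwichTransport` + the relative
sandwich `RelInvSandwich.sandwich_conjV_rel` + rule `.EMA` entrywise), claimed by an3-g30 («E3-CONTACT-EVAL-L1», level 1) and requested level-
generically (journal); it is a HYPOTHESIS here, stated so that that theorem discharges it by instantiation.  All declarations `[folklore]`; axioms
standard.  Provenance: b2b-balaban β sub-cell, unit beta-an2 gen 16, 2026-08-20 (v1); no existing file touched.
-/

open Finset
open scoped BigOperators
open Literature.MathematicalPhysics.QuantumFieldTheory
open Literature.MathematicalPhysics.QuantumFieldTheory.Balaban1983to89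
open Literature.MathematicalPhysics.QuantumFieldTheory.Balaban1983to89.Beta
open ExpKernelCalculus (MKer Decays BiLoc comp VertexFamily VertexFamily₂ shiftK)
open AffineAveraging (box toSite)
open AveragingContoursRooted (ctr ctrOff ctrOff_mem_box)
open PolarizationSign (reflSign AxisReflectionCovariant)
open KernelReflection (refK)
open ResolventReflection (bref Φ)
open OneStepResolventKernel (Fib LocStencil JetData)
open OneStepKernelFamily (KInvStep vertexOfK TbalOf flipK)
open BalabanStepJetsSucc (mmRead wE wVH)
open Summit.QuantumFields.BalabanUV.Beta.TameKernelCalculus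
open Summit.QuantumFields.BalabanUV.Beta.ChartConjugation (conjV conjW)
open Summit.QuantumFields.BalabanUV.Beta.ChartConjugationRelative (RelInv)
open Summit.QuantumFields.BalabanUV.Beta.AxialDressingRooted (coDressKBmAt axEc one_le_of_neZero)
open Summit.QuantumFields.BalabanUV.Beta.BorderedHessian (bhKAt diagK ctGen cCT comp_axEc_diagK_comm locStencil_smul_diagK_ctGen bhKStepAt
  bhKStepAt_zero stepScale stepScale_ne_zero bhKStepAt_succ_fm bhKStepAt_succ_mf bhKStepAt_succ_mm spr_bhKStepAt relInv_coDressKBmAt_KInvStep_bhKStepAt)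
open Summit.QuantumFields.BalabanUV.Beta.S0NAtReflection (S0NAt_bref)
open Summit.QuantumFields.BalabanUV.Beta.WardLocusRecursive (SrecAt SrecAt_zero)
open Summit.QuantumFields.BalabanUV.Beta.WardLocusInduction (wVH_eq_stepScale_sq wE_eq_stepScale_cube)
open Summit.QuantumFields.BalabanUV.Beta.KernelWardLevels (stepScale_zero)

noncomputable section

namespace Summit.QuantumFields.BalabanUV.Beta.SpineRooted

/-! ## §1 The (Sr-conj) socket at every level, by induction -/

section Induction

variable {Lc : ℕ} [NeZero Lc]

omit [NeZero Lc] in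
/-- [folklore] `wVH 3 Lc 0 = 1`. -/
theorem wVH_zero : wVH 3 Lc 0 = 1 := by simp [BalabanStepJetsSucc.wVH]

omit [NeZero Lc] in
/-- [folklore] `γ_0 = cVH / Lc⁴` for the uniform coefficient sequence `γ_j = cVH·wVH j / (stepScale j·Lc⁴)`. -/
theorem gammaRec_zero (cVH : ℝ) : cVH * wVH 3 Lc 0 / (stepScale 3 Lc 0 * (Lc : ℝ) ^ 4) = cVH / (Lc : ℝ) ^ 4 := by
  rw [wVH_zero, stepScale_zero, mul_one, one_mul]

/-- [folklore] **THE (Sr-conj) LAW OF EVERY MEMBER OF THE RECURSIVE FAMILY, FROM THE LEVEL-GENERIC CONTACT LAW AND THE LOCKS** (see the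
module docstring for (P j), (Q j)): `2·cVH = −cE·Lc⁴`, `hCT : ∀ j, P j → Q j`, `hlock` ⟹ `∀ j, P j`. -/
theorem hSrC_SrecAt_all_of_contactLaw (hLc : Odd Lc) (cE cVH cΛ : ℝ) (hn : 2 * cVH = -(cE * (Lc : ℝ) ^ 4)) (γ : ℕ → ℝ)
    (hγ : ∀ j, γ j = cVH * wVH 3 Lc j / (stepScale 3 Lc j * (Lc : ℝ) ^ 4))
    (hlock : ∀ j, cE * wE 3 Lc (j + 1) * (γ j / (stepScale 3 Lc j * (Lc : ℝ) ^ 4 * wVH 3 Lc (j + 1))) = γ (j + 1))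
    (hCT : ∀ j : ℕ,
      (∀ (α κ : Fin 4) (u : Fin 4 → ℤ),
        SrecAt 3 Lc (toSite (ctrOff 4 Lc)) cE cVH cΛ j κ (bref α κ u) =
          reflSign α κ • refK (Φ Lc α) (SrecAt 3 Lc (toSite (ctrOff 4 Lc)) cE cVH cΛ j κ u +
            conjV (bhKStepAt 3 (toSite (ctrOff 4 Lc)) Lc j) (γ j • diagK (ctGen 3 α Lc κ u)))) →
      ∀ (α κ' : Fin 4) (u' x z : Fin 4 → ℤ) (a b : Fin 4),
        e3OfK Lc (coDressKBmAt (toSite (ctrOff 4 Lc)) Lc (KInvStep (d := 3) Lc j)) (SrecAt 3 Lc (toSite (ctrOff 4 Lc)) cE cVH cΛ j) κ'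
            (bref α κ' u') x z (Sum.inl a) (Sum.inl b) =
          reflSign α κ' * ((Φ Lc α).s (Sum.inl a) * (Φ Lc α).s (Sum.inl b) *
            (e3OfK Lc (coDressKBmAt (toSite (ctrOff 4 Lc)) Lc (KInvStep (d := 3) Lc j)) (SrecAt 3 Lc (toSite (ctrOff 4 Lc)) cE cVH cΛ j) κ' u'
                ((Φ Lc α).r (Sum.inl a) x) ((Φ Lc α).r (Sum.inl b) z) (Sum.inl a) (Sum.inl b) +
              γ j / (stepScale 3 Lc j * (Lc : ℝ) ^ 4 * wVH 3 Lc (j + 1)) *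
                conjV (bhKStepAt 3 (toSite (ctrOff 4 Lc)) Lc (j + 1)) (diagK (ctGen 3 α Lc κ' u'))
                  ((Φ Lc α).r (Sum.inl a) x) ((Φ Lc α).r (Sum.inl b) z) (Sum.inl a) (Sum.inl b)))) :
    ∀ (j : ℕ) (α κ : Fin 4) (u : Fin 4 → ℤ),
      SrecAt 3 Lc (toSite (ctrOff 4 Lc)) cE cVH cΛ j κ (bref α κ u) =
        reflSign α κ • refK (Φ Lc α) (SrecAt 3 Lc (toSite (ctrOff 4 Lc)) cE cVH cΛ j κ u +
          conjV (bhKStepAt 3 (toSite (ctrOff 4 Lc)) Lc j) (γ j • diagK (ctGen 3 α Lc κ u))) := by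
  intro j
  induction j with
  | zero =>
    intro α κ u
    rw [SrecAt_zero, bhKStepAt_zero, hγ, gammaRec_zero]
    exact S0NAt_bref (d := 3) hLc cΛ hn α κ u
  | succ j ih =>
    intro α κ u
    have hQ := hCT j ih
    have hc : cE * wE 3 Lc (j + 1) * (γ j / (stepScale 3 Lc j * (Lc : ℝ) ^ 4 * wVH 3 Lc (j + 1))) =
        cVH * wVH 3 Lc (j + 1) / (stepScale 3 Lc (j + 1) * (Lc : ℝ) ^ 4) := by rw [hlock, hγ]
    rw [hγ]
    exact SrecAt_succ_bref_of_e3Law (d := 3) hLc cE cVH cΛ j (stepScale_ne_zero (j + 1)) (fun x z β μ => bhKStepAt_succ_fm j x z β μ)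
      (fun x z μ β => bhKStepAt_succ_mf j x z μ β) (fun x z μ μ' => bhKStepAt_succ_mm j x z μ μ')
      (γ j / (stepScale 3 Lc j * (Lc : ℝ) ^ 4 * wVH 3 Lc (j + 1))) hc hQ α κ u

/-! ## §2 The locks from the pin -/

/-- [folklore] **THE UNITS LOCKS FROM THE PIN** `∀ j, cE·wE (j+1) = stepScale (j+1)³·Lc⁴` (leaf-10's `stepLocks_iff` relation; `wVH = stepScale²`). -/
theorem locks_of_pin (cE cVH : ℝ) (hpin : ∀ j, cE * wE 3 Lc (j + 1) = stepScale 3 Lc (j + 1) ^ 3 * (Lc : ℝ) ^ 4) (j : ℕ) :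
    cE * wE 3 Lc (j + 1) * (cVH * wVH 3 Lc j / (stepScale 3 Lc j * (Lc : ℝ) ^ 4) / (stepScale 3 Lc j * (Lc : ℝ) ^ 4 * wVH 3 Lc (j + 1))) =
      cVH * wVH 3 Lc (j + 1) / (stepScale 3 Lc (j + 1) * (Lc : ℝ) ^ 4) := by
  have hL : (Lc : ℝ) ≠ 0 := by exact_mod_cast NeZero.ne Lc
  have hs0 : stepScale 3 Lc j ≠ 0 := stepScale_ne_zero j
  have hs1 : stepScale 3 Lc (j + 1) ≠ 0 := stepScale_ne_zero (j + 1)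
  rw [hpin, wVH_eq_stepScale_sq, wVH_eq_stepScale_sq]
  field_simp

omit [NeZero Lc] in
/-- [folklore] At the tree's numerals (`wE = stepScale³`) the pin reads `cE = Lc⁴`. -/
theorem pin_of_bcj (cE : ℝ) (hcE : cE = (Lc : ℝ) ^ 4) (j : ℕ) : cE * wE 3 Lc (j + 1) = stepScale 3 Lc (j + 1) ^ 3 * (Lc : ℝ) ^ 4 := by
  rw [hcE, wE_eq_stepScale_cube]; ring

end Induction

/-! ## §3 The `hR` root for the recursive literal, (Sr-conj) by induction -/

section Root

/-- [folklore] **`hR` FOR THE RECURSIVELY TYPED WALL FAMILY, INDUCTIVE FORM**: `∀ j, AxisReflectionCovariant (flipK (TbalOf Lc (JsRecBmAtOf …) j))`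
(`d + 1 = 4`, odd `Lc`, centred root) from EXACTLY the W-data, `hn : 2·cVH = −cE·Lc⁴`, the level-generic contact law `hCT`, the units locks
`hlock`, and the W-supplier's sockets (`X₂`, `hX₂`, `hEX₂`, `hWrC` against `bhKStepAt` with contact symbol `γ_j • diagK ctGen`).  Inside: rules
1–4 at every level (`relInv_coDressKBmAt_KInvStep_bhKStepAt`), localisation / `axEc`-commutation of the contact family, and the (Sr-conj) socket
(`hSrC_SrecAt_all_of_contactLaw`).  Discharges nothing of the wall by itself. -/
theorem axisReflectionCovariant_flipK_TbalOf_JsRecBmAtOf_ctrC_inductive {Lc : ℕ} [NeZero Lc] (hLc : Odd Lc) (cE cVH cΛ : ℝ)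
    (hn : 2 * cVH = -(cE * (Lc : ℝ) ^ 4))
    (W : ℕ → Fin 4 → (Fin 4 → ℤ) → Fin 4 → (Fin 4 → ℤ) → MKer 4 (Fib 3)) (Cw δw : ℕ → ℝ) (hδw : ∀ j, 0 < δw j)
    (hW : ∀ j, VertexFamily₂ (W j) Lc (Cw j) (δw j))
    (hWt : ∀ (j : ℕ) (μ : Fin 4) (y : Fin 4 → ℤ) (ν : Fin 4) (y' t : Fin 4 → ℤ),
      W j μ (y + t) ν (y' + t) = shiftK (-((Lc : ℤ) • t)) (W j μ y ν y'))
    (γ : ℕ → ℝ) (hγ : ∀ j, γ j = cVH * wVH 3 Lc j / (stepScale 3 Lc j * (Lc : ℝ) ^ 4))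
    (hlock : ∀ j, cE * wE 3 Lc (j + 1) * (γ j / (stepScale 3 Lc j * (Lc : ℝ) ^ 4 * wVH 3 Lc (j + 1))) = γ (j + 1))
    (hCT : ∀ j : ℕ,
      (∀ (α κ : Fin 4) (u : Fin 4 → ℤ),
        SrecAt 3 Lc (toSite (ctrOff 4 Lc)) cE cVH cΛ j κ (bref α κ u) =
          reflSign α κ • refK (Φ Lc α) (SrecAt 3 Lc (toSite (ctrOff 4 Lc)) cE cVH cΛ j κ u +
            conjV (bhKStepAt 3 (toSite (ctrOff 4 Lc)) Lc j) (γ j • diagK (ctGen 3 α Lc κ u)))) →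
      ∀ (α κ' : Fin 4) (u' x z : Fin 4 → ℤ) (a b : Fin 4),
        e3OfK Lc (coDressKBmAt (toSite (ctrOff 4 Lc)) Lc (KInvStep (d := 3) Lc j)) (SrecAt 3 Lc (toSite (ctrOff 4 Lc)) cE cVH cΛ j) κ'
            (bref α κ' u') x z (Sum.inl a) (Sum.inl b) =
          reflSign α κ' * ((Φ Lc α).s (Sum.inl a) * (Φ Lc α).s (Sum.inl b) *
            (e3OfK Lc (coDressKBmAt (toSite (ctrOff 4 Lc)) Lc (KInvStep (d := 3) Lc j)) (SrecAt 3 Lc (toSite (ctrOff 4 Lc)) cE cVH cΛ j) κ' u'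
                ((Φ Lc α).r (Sum.inl a) x) ((Φ Lc α).r (Sum.inl b) z) (Sum.inl a) (Sum.inl b) +
              γ j / (stepScale 3 Lc j * (Lc : ℝ) ^ 4 * wVH 3 Lc (j + 1)) *
                conjV (bhKStepAt 3 (toSite (ctrOff 4 Lc)) Lc (j + 1)) (diagK (ctGen 3 α Lc κ' u'))
                  ((Φ Lc α).r (Sum.inl a) x) ((Φ Lc α).r (Sum.inl b) z) (Sum.inl a) (Sum.inl b))))
    (X₂ : ℕ → Fin 4 → Fin 4 → (Fin 4 → ℤ) → Fin 4 → (Fin 4 → ℤ) → MKer 4 (Fib 3)) (hX₂ : ∀ j α μ y ν y', Loc (X₂ j α μ y ν y'))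
    (hEX₂ : ∀ j α μ y ν y', comp (axEc (toSite (ctrOff 4 Lc)) Lc) (X₂ j α μ y ν y') = comp (X₂ j α μ y ν y') (axEc (toSite (ctrOff 4 Lc)) Lc))
    (hWrC : ∀ (j : ℕ) (α μ : Fin 4) (y : Fin 4 → ℤ) (ν : Fin 4) (y' : Fin 4 → ℤ),
      (JsRec0AtOf (d := 3) hLc.pos (ctrOff_mem_box hLc.pos) cE cVH cΛ W Cw δw hδw hW j).W μ (bref α μ y) ν (bref α ν y') =
        (reflSign α μ * reflSign α ν) • refK (Φ Lc α)
          ((JsRec0AtOf (d := 3) hLc.pos (ctrOff_mem_box hLc.pos) cE cVH cΛ W Cw δw hδw hW j).W μ y ν y' +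
            conjW (bhKStepAt 3 (toSite (ctrOff 4 Lc)) Lc j)
              (vertexOfK (coDressKBmAt (toSite (ctrOff 4 Lc)) Lc (KInvStep (d := 3) Lc j)) Lc
                (JsRec0AtOf (d := 3) hLc.pos (ctrOff_mem_box hLc.pos) cE cVH cΛ W Cw δw hδw hW j).S μ y)
              (vertexOfK (coDressKBmAt (toSite (ctrOff 4 Lc)) Lc (KInvStep (d := 3) Lc j)) Lc
                (JsRec0AtOf (d := 3) hLc.pos (ctrOff_mem_box hLc.pos) cE cVH cΛ W Cw δw hδw hW j).S ν y')
              (vertexOfK (coDressKBmAt (toSite (ctrOff 4 Lc)) Lc (KInvStep (d := 3) Lc j)) Lc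
                (fun κ u => γ j • diagK (ctGen 3 α Lc κ u)) μ y)
              (vertexOfK (coDressKBmAt (toSite (ctrOff 4 Lc)) Lc (KInvStep (d := 3) Lc j)) Lc
                (fun κ u => γ j • diagK (ctGen 3 α Lc κ u)) ν y') (X₂ j α μ y ν y'))) :
    ∀ j : ℕ, AxisReflectionCovariant
      (flipK (TbalOf Lc (JsRecBmAtOf (d := 3) hLc.pos (ctrOff_mem_box hLc.pos) cE cVH cΛ W Cw δw hδw hW) j)) := by
  have hL1 : 1 ≤ Lc := one_le_of_neZero Lc
  have hRel := relInv_coDressKBmAt_KInvStep_bhKStepAt (d := 3) (Lc := Lc) (ctrOff_mem_box hL1)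
  -- the contact family `C j α κ u := γ j • diagK (ctGen 3 α Lc κ u)`: localisation and commutation with `axEc`
  have hC : ∀ j (α : Fin 4), LocStencil (fun κ u => γ j • diagK (ctGen 3 α Lc κ u)) (|γ j| * cCT 3 Lc 1) 1 :=
    fun j α => locStencil_smul_diagK_ctGen α Lc (γ j) zero_le_one
  have hEC : ∀ j (α κ : Fin 4) (u : Fin 4 → ℤ), comp (axEc (toSite (ctrOff 4 Lc)) Lc) ((fun κ u => γ j • diagK (ctGen 3 α Lc κ u)) κ u) =
      comp ((fun κ u => γ j • diagK (ctGen 3 α Lc κ u)) κ u) (axEc (toSite (ctrOff 4 Lc)) Lc) := by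
    intro j α κ u
    show comp (axEc (toSite (ctrOff 4 Lc)) Lc) (γ j • diagK (ctGen 3 α Lc κ u)) = comp (γ j • diagK (ctGen 3 α Lc κ u)) (axEc (toSite (ctrOff 4 Lc)) Lc)
    rw [KernelReflection.comp_smul_right, KernelReflection.comp_smul_left, comp_axEc_diagK_comm]
  -- the (Sr-conj) socket, every level, by induction
  have hSrC := hSrC_SrecAt_all_of_contactLaw hLc cE cVH cΛ hn γ hγ hlock hCT
  exact axisReflectionCovariant_flipK_TbalOf_JsRecBmAtOf_ctrC hLc cE cVH cΛ W Cw δw hδw hW hWt (bhKStepAt 3 (toSite (ctrOff 4 Lc)) Lc)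
    (spr_bhKStepAt (ctrOff_mem_box hL1)) (fun j => (hRel j).AME) (fun j => (hRel j).EMA)
    (fun j α κ u => γ j • diagK (ctGen 3 α Lc κ u)) (fun j => |γ j| * cCT 3 Lc 1) (fun _ => 1) hC (fun _ => one_pos) X₂ hX₂ hEC hEX₂
    (fun j α κ u => by rw [JsRec0AtOf_S]; exact hSrC j α κ u) hWrC

/-- [folklore] **THE SAME AT THE PIN `cE = Lc⁴`, `cVH = −Lc⁸/2`** (the tree's numerals `wE = stepScale³`; `hn` and `hlock` DISCHARGED by
`pin_of_bcj`/`locks_of_pin`): what is left of `hR` for the recursive literal at this pin is the level-generic contact law `hCT` and the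
W-side (L4). -/
theorem axisReflectionCovariant_flipK_TbalOf_JsRecBmAtOf_ctrC_inductive_bcj {Lc : ℕ} [NeZero Lc] (hLc : Odd Lc) (cΛ : ℝ)
    (W : ℕ → Fin 4 → (Fin 4 → ℤ) → Fin 4 → (Fin 4 → ℤ) → MKer 4 (Fib 3)) (Cw δw : ℕ → ℝ) (hδw : ∀ j, 0 < δw j)
    (hW : ∀ j, VertexFamily₂ (W j) Lc (Cw j) (δw j))
    (hWt : ∀ (j : ℕ) (μ : Fin 4) (y : Fin 4 → ℤ) (ν : Fin 4) (y' t : Fin 4 → ℤ),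
      W j μ (y + t) ν (y' + t) = shiftK (-((Lc : ℤ) • t)) (W j μ y ν y'))
    (γ : ℕ → ℝ) (hγ : ∀ j, γ j = -((Lc : ℝ) ^ 8 / 2) * wVH 3 Lc j / (stepScale 3 Lc j * (Lc : ℝ) ^ 4))
    (hCT : ∀ j : ℕ,
      (∀ (α κ : Fin 4) (u : Fin 4 → ℤ),
        SrecAt 3 Lc (toSite (ctrOff 4 Lc)) ((Lc : ℝ) ^ 4) (-((Lc : ℝ) ^ 8 / 2)) cΛ j κ (bref α κ u) =
          reflSign α κ • refK (Φ Lc α) (SrecAt 3 Lc (toSite (ctrOff 4 Lc)) ((Lc : ℝ) ^ 4) (-((Lc : ℝ) ^ 8 / 2)) cΛ j κ u +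
            conjV (bhKStepAt 3 (toSite (ctrOff 4 Lc)) Lc j) (γ j • diagK (ctGen 3 α Lc κ u)))) →
      ∀ (α κ' : Fin 4) (u' x z : Fin 4 → ℤ) (a b : Fin 4),
        e3OfK Lc (coDressKBmAt (toSite (ctrOff 4 Lc)) Lc (KInvStep (d := 3) Lc j))
            (SrecAt 3 Lc (toSite (ctrOff 4 Lc)) ((Lc : ℝ) ^ 4) (-((Lc : ℝ) ^ 8 / 2)) cΛ j) κ' (bref α κ' u') x z (Sum.inl a) (Sum.inl b) =
          reflSign α κ' * ((Φ Lc α).s (Sum.inl a) * (Φ Lc α).s (Sum.inl b) *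
            (e3OfK Lc (coDressKBmAt (toSite (ctrOff 4 Lc)) Lc (KInvStep (d := 3) Lc j))
                (SrecAt 3 Lc (toSite (ctrOff 4 Lc)) ((Lc : ℝ) ^ 4) (-((Lc : ℝ) ^ 8 / 2)) cΛ j) κ' u'
                ((Φ Lc α).r (Sum.inl a) x) ((Φ Lc α).r (Sum.inl b) z) (Sum.inl a) (Sum.inl b) +
              γ j / (stepScale 3 Lc j * (Lc : ℝ) ^ 4 * wVH 3 Lc (j + 1)) *
                conjV (bhKStepAt 3 (toSite (ctrOff 4 Lc)) Lc (j + 1)) (diagK (ctGen 3 α Lc κ' u'))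
                  ((Φ Lc α).r (Sum.inl a) x) ((Φ Lc α).r (Sum.inl b) z) (Sum.inl a) (Sum.inl b))))
    (X₂ : ℕ → Fin 4 → Fin 4 → (Fin 4 → ℤ) → Fin 4 → (Fin 4 → ℤ) → MKer 4 (Fib 3)) (hX₂ : ∀ j α μ y ν y', Loc (X₂ j α μ y ν y'))
    (hEX₂ : ∀ j α μ y ν y', comp (axEc (toSite (ctrOff 4 Lc)) Lc) (X₂ j α μ y ν y') = comp (X₂ j α μ y ν y') (axEc (toSite (ctrOff 4 Lc)) Lc))
    (hWrC : ∀ (j : ℕ) (α μ : Fin 4) (y : Fin 4 → ℤ) (ν : Fin 4) (y' : Fin 4 → ℤ),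
      (JsRec0AtOf (d := 3) hLc.pos (ctrOff_mem_box hLc.pos) ((Lc : ℝ) ^ 4) (-((Lc : ℝ) ^ 8 / 2)) cΛ W Cw δw hδw hW j).W μ (bref α μ y) ν
          (bref α ν y') =
        (reflSign α μ * reflSign α ν) • refK (Φ Lc α)
          ((JsRec0AtOf (d := 3) hLc.pos (ctrOff_mem_box hLc.pos) ((Lc : ℝ) ^ 4) (-((Lc : ℝ) ^ 8 / 2)) cΛ W Cw δw hδw hW j).W μ y ν y' +
            conjW (bhKStepAt 3 (toSite (ctrOff 4 Lc)) Lc j)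
              (vertexOfK (coDressKBmAt (toSite (ctrOff 4 Lc)) Lc (KInvStep (d := 3) Lc j)) Lc
                (JsRec0AtOf (d := 3) hLc.pos (ctrOff_mem_box hLc.pos) ((Lc : ℝ) ^ 4) (-((Lc : ℝ) ^ 8 / 2)) cΛ W Cw δw hδw hW j).S μ y)
              (vertexOfK (coDressKBmAt (toSite (ctrOff 4 Lc)) Lc (KInvStep (d := 3) Lc j)) Lc
                (JsRec0AtOf (d := 3) hLc.pos (ctrOff_mem_box hLc.pos) ((Lc : ℝ) ^ 4) (-((Lc : ℝ) ^ 8 / 2)) cΛ W Cw δw hδw hW j).S ν y')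
              (vertexOfK (coDressKBmAt (toSite (ctrOff 4 Lc)) Lc (KInvStep (d := 3) Lc j)) Lc
                (fun κ u => γ j • diagK (ctGen 3 α Lc κ u)) μ y)
              (vertexOfK (coDressKBmAt (toSite (ctrOff 4 Lc)) Lc (KInvStep (d := 3) Lc j)) Lc
                (fun κ u => γ j • diagK (ctGen 3 α Lc κ u)) ν y') (X₂ j α μ y ν y'))) :
    ∀ j : ℕ, AxisReflectionCovariant
      (flipK (TbalOf Lc (JsRecBmAtOf (d := 3) hLc.pos (ctrOff_mem_box hLc.pos) ((Lc : ℝ) ^ 4) (-((Lc : ℝ) ^ 8 / 2)) cΛ W Cw δw hδw hW) j)) := by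
  refine axisReflectionCovariant_flipK_TbalOf_JsRecBmAtOf_ctrC_inductive hLc ((Lc : ℝ) ^ 4) (-((Lc : ℝ) ^ 8 / 2)) cΛ (by ring) W Cw δw hδw
    hW hWt γ hγ (fun j => ?_) hCT X₂ hX₂ hEX₂ hWrC
  rw [hγ, hγ]
  exact locks_of_pin (Lc := Lc) ((Lc : ℝ) ^ 4) (-((Lc : ℝ) ^ 8 / 2)) (pin_of_bcj (Lc := Lc) _ rfl) j

end Root

end Summit.QuantumFields.BalabanUV.Beta.SpineRooted

end
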